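import Summits.ResolutionOfSingularities.ResolutionOfSingularities.Theorems.EquisingularLiftEquisingularLiftNatSubchainSupplierInvSLDefs
import Summits.ResolutionOfSingularities.ResolutionOfSingularities.Theorems.EquisingularLiftEquisingularLiftNatRegularOfSpecialFibre
import HarnessLib

/-!
# [OURS · L1 W4.5(b) · EL♮(3) · crux-idea `toric-towers` ROUND 17 · Δ1/Δ3 TYPED] `PreLetterDatum` and its PROMOTION to `TCPlus.LetterDatum`

res-L1-w45b-idea-1 g26 (IDEATOR k = 1; crux-ideate on stmt-ResolutionOfSingularities-20148 `EquisingularLiftNatThree`, route `EquisingularLift`,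
line `sections`).  OURS · counted 0 · AI-written, weaker than expert review · NOT a statement of any manuscript ([Hironaka2017] is a candidate
under adjudication; nothing of it is asserted) · EL♮(3) NOT proved.  Definitions + pure-logic / one-citation wrappers only (no `sorry`, no
instance, no notation; standard axioms).  Companion of `Cruxes/EquisingularLiftNatThree/KeyPolynomialLettersR17.lean` (chart identities) and of
the card `Ideas/toric-towers.md` §ROUND 17 (R17-2 «PRICE ON EVIDENCE»).

WHAT.  KEY LETTERS v2 (R17) carries a SINGULAR hypersurface member (the du Val key letter `M_O`) through the two moves at which it is not yet
regular («immature host»).  The engines' letter currency `TCPlus.LetterDatum O P q Y G X σ jG L` (…NatSubchainSupplierInvSLDefs l.79) demands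
(l-iii) `Scheme.IsRegular 𝓛.subscheme`; Δ1 of the card is the same datum WITHOUT (l-iii):
* `PreLetterDatumWith … L 𝓛` := (l-i) reduced trace `𝓛.comap jG = 𝓘⟨closure L⟩` ∧ (l-ii) stalkwise principal ∧ (l-iv) off the generic point of `Y`
  ∧ (l-v) `V(𝓛) → Spec O` flat — for an EXPLICIT model `𝓛`;  `PreLetterDatum` := `∃ 𝓛, PreLetterDatumWith … 𝓛`;
* `preLetterDatum_of_letterDatum` (forget (l-iii));  `letterDatum_of_preLetterDatumWith_of_isRegular` (re-insert it);
* Δ3 PROMOTION `letterDatum_of_preLetterDatumWith_of_forall_over_closedPoint`: if `V(𝓛)` is universally closed over `Spec O` (e.g. `X` proper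
  over `O`) and the quotient stalks `𝒪_{X,x}/𝓛_x` are regular at every point of `supp 𝓛` over the closed point of `O`, the pre-letter IS a letter —
  one citation of the tree's `Scheme.isRegular_subscheme_of_forall_over_closedPoint` (…NatRegularOfSpecialFibre; regular along the special fibre ⇒
  regular).  The special-point regularity is what T-M1-EXACT + `isRegularLocalRing_quotient_of_reduction_notMem_sq` (…NatEquimultipleStrictTransform
  ✓ p515745) deliver chartwise once the downstairs strict transform `St²M` is regular (kit R16-3 / R17-5); the equimultiplicity hypothesis of each
  immature step is a hypothesis OF THE STEP relative to its centre (T-M1-EXACT's `hΦb`), not a clause of the datum.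
Nothing here is a theorem about resolution; these are the typed shapes the card prices (Δ1 = S, Δ3 = S).
-/

set_option linter.dupNamespace false -- mandated namespace of this single-conjunct summit

noncomputable section

open CategoryTheory CategoryTheory.Limits AlgebraicGeometry TopologicalSpace Topology IsLocalRing
open Literature.AlgebraicGeometry.Resolution
open AlgebraicGeometry.Scheme.IdealSheafData
open Summit.ResolutionOfSingularities.ResolutionOfSingularities.Cruxes.EquisingularLiftNat.Sections

namespace Summit.ResolutionOfSingularities.ResolutionOfSingularities.Cruxes.EquisingularLiftNatThree.ToricTowers.R17Defs

variable (O : Type) [CommRing O] (P : Scheme.{0}) (q : P ⟶ Spec (.of O)) (Y : Set P)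

/-- **`PreLetterDatumWith`** — clauses (l-i), (l-ii), (l-iv), (l-v) of `TCPlus.LetterDatum` for an EXPLICIT model `𝓛` (no regularity clause).
[OURS · L1 W4.5b · crux-idea toric-towers R17 Δ1] -/
def PreLetterDatumWith (G X : Scheme.{0}) (σ : X ⟶ P) (jG : G ⟶ X) (L : Set G) (𝓛 : X.IdealSheafData) : Prop :=
  𝓛.comap jG = vanishingIdeal (⟨closure L, isClosed_closure⟩ : Closeds G) ∧
    (∀ z : X, (stalkIdeal 𝓛 z).IsPrincipal) ∧
    σ '' (𝓛.support : Set X) ⊆ {y : P | ¬ IsGenericPoint y Y} ∧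
    Flat (𝓛.subschemeι ≫ σ ≫ q)

/-- **`PreLetterDatum`** — `TCPlus.LetterDatum` without (l-iii): SOME model with reduced trace, stalkwise principal, off the generic point of `Y`,
`O`-flat. [OURS · L1 W4.5b · crux-idea toric-towers R17 Δ1] -/
def PreLetterDatum (G X : Scheme.{0}) (σ : X ⟶ P) (jG : G ⟶ X) (L : Set G) : Prop :=
  ∃ 𝓛 : X.IdealSheafData, PreLetterDatumWith O P q Y G X σ jG L 𝓛

variable {O P q Y}

/-- A letter is a pre-letter (forget (l-iii)). [OURS · pure logic] -/
theorem preLetterDatum_of_letterDatum {G X : Scheme.{0}} {σ : X ⟶ P} {jG : G ⟶ X} {L : Set G}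
    (h : TCPlus.LetterDatum O P q Y G X σ jG L) : PreLetterDatum O P q Y G X σ jG L := by
  obtain ⟨𝓛, h1, h2, -, h4, h5⟩ := h
  exact ⟨𝓛, h1, h2, h4, h5⟩

/-- A pre-letter whose explicit model is regular is a letter (re-insert (l-iii)). [OURS · pure logic] -/
theorem letterDatum_of_preLetterDatumWith_of_isRegular {G X : Scheme.{0}} {σ : X ⟶ P} {jG : G ⟶ X} {L : Set G}
    {𝓛 : X.IdealSheafData} (h : PreLetterDatumWith O P q Y G X σ jG L 𝓛) (hreg : Scheme.IsRegular 𝓛.subscheme) :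
    TCPlus.LetterDatum O P q Y G X σ jG L := by
  obtain ⟨h1, h2, h4, h5⟩ := h
  exact ⟨𝓛, h1, h2, hreg, h4, h5⟩

/-- **PROMOTION (Δ3).** A pre-letter whose model `V(𝓛)` is universally closed over `Spec O` and whose quotient stalks `𝒪_{X,x} ⧸ 𝓛_x` are
regular local rings at every point of `supp 𝓛` over the closed point of `O` is a LETTER: `V(𝓛)` is regular by the tree's
`Scheme.isRegular_subscheme_of_forall_over_closedPoint` (regular along the special fibre ⇒ regular: every point specialises to a special
point, and localisations of regular local rings are regular). [OURS · L1 W4.5b · crux-idea toric-towers R17 Δ3; one citation] -/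
theorem letterDatum_of_preLetterDatumWith_of_forall_over_closedPoint [IsLocalRing O] {G X : Scheme.{0}} {σ : X ⟶ P} {jG : G ⟶ X} {L : Set G}
    {𝓛 : X.IdealSheafData} (h : PreLetterDatumWith O P q Y G X σ jG L 𝓛)
    [UniversallyClosed (𝓛.subschemeι ≫ σ ≫ q)]
    (hreg : ∀ x ∈ (𝓛.support : Set X), (σ ≫ q) x = closedPoint O →
      IsRegularLocalRing (X.presheaf.stalk x ⧸ stalkIdeal 𝓛 x)) :
    TCPlus.LetterDatum O P q Y G X σ jG L :=
  letterDatum_of_preLetterDatumWith_of_isRegular h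
    (Scheme.isRegular_subscheme_of_forall_over_closedPoint (σ ≫ q) 𝓛 hreg)

/-- The same for a WHOLE LIST of pre-letters sharing the stage (the shape `TCPlus.MemberSL` consumes: `∀ L ∈ Ls, LetterDatum …`).
[OURS · pure logic over Δ3] -/
theorem forall_letterDatum_of_preLetterDatumWith [IsLocalRing O] {G X : Scheme.{0}} {σ : X ⟶ P} {jG : G ⟶ X} {Ls : List (Set G)}
    (𝓛 : Set G → X.IdealSheafData) (h : ∀ L ∈ Ls, PreLetterDatumWith O P q Y G X σ jG L (𝓛 L))
    (huc : ∀ L ∈ Ls, UniversallyClosed ((𝓛 L).subschemeι ≫ σ ≫ q))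
    (hreg : ∀ L ∈ Ls, ∀ x ∈ ((𝓛 L).support : Set X), (σ ≫ q) x = closedPoint O →
      IsRegularLocalRing (X.presheaf.stalk x ⧸ stalkIdeal (𝓛 L) x)) :
    ∀ L ∈ Ls, TCPlus.LetterDatum O P q Y G X σ jG L := fun L hL =>
  haveI := huc L hL
  letterDatum_of_preLetterDatumWith_of_forall_over_closedPoint (h L hL) (hreg L hL)

end Summit.ResolutionOfSingularities.ResolutionOfSingularities.Cruxes.EquisingularLiftNatThree.ToricTowers.R17Defs

end
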